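import Summits.ResolutionOfSingularities.ResolutionOfSingularities.Theorems.WeightedInvariantIotaOrder
import HarnessLib

/-!
# STRATUM-EXACTNESS IS BOOKKEEPING: the stratum iff of (open″) `JOpenPresentationForallSing` follows from the
# (strat)+(adm) conjuncts of the canonical game clause, generization monotonicity and closedness of superlevel sets
# — door `HypersurfaceCentreConstruction` (stmt-ResolutionOfSingularities-19897), route `WeightedInvariant`

[OURS · L1 W4.3 · cell `res-hironaka`, HUMAN RULING D-0089] Helper file `--supports stmt-ResolutionOfSingularities-19897`.
Kernel form of res-L1-w43-tri-2's TRIAGE v5 readback (D7) (HOME/STATUS 2026-08-27T07:02:26Z): «(open″): its stratum iff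
minus the J-presentation is DERIVABLE from (strat)+(adm)+(c7)+(c8)+Noetherian closedness up to shrinking h (non-closed 𝔪
fine: the jump set is closed ∌ 𝔪); the ONLY new content over H2a‴ is J-COHERENCE». Typer res-type-073 (gen 10). AI-produced,
weaker than expert review. NOT a statement of the manuscript under review (Hironaka 2017, [claim: Hironaka2017, status:
under-review]); nothing here is attributed to its author; nothing here is a claim about resolution of singularities. `J`-free
and `ι`-general; no definitions.

## The statement being unbundled

(open″) (`Theorems/WeightedInvariantHypersurfaceLocalGameEFT4S.lean`, `JOpenPresentationForallSing p ι J`) asks, for every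
finite-type model `(A, 𝔪, F)` of a position, for `h ∉ 𝔪` and ONE positively weighted system `U` such that on `D(h)`:
`(∀ i, U i ∈ 𝔮) ↔ (F ∈ 𝔪_𝔮² ∧ ι(A_𝔮) F = ι(A_𝔪) F)` (STRATUM-EXACTNESS) and, on that stratum, `J` is presented by `U, W`
(J-COHERENCE). Since the positively weighted members span the centre prime `P` ((pres) of `CanonicalGameClause`), stratum
exactness says: near `𝔪`, `V(P)` IS the set of singular points of the hypersurface with the same `ι`-value as `𝔪`. This
file proves that sentence from data every candidate `ι` must carry anyway:

* `stratumIff_of_strat` — ABSTRACT SPECTRUM LEMMA. `A` Noetherian, `𝔪 ∈ Spec A`, `h₀ ∉ 𝔪`; ANY functions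
  `v : Spec A → Ordinal` (think `𝔮 ↦ ι(A_𝔮) F`) and `Sg : Spec A → Prop` (think `F ∈ 𝔪_{A_𝔮}²`). Hypotheses, all on the
  basic open `D(h₀)` only: `v` does not decrease under specialization (generization monotonicity, (c7)); the superlevel
  sets `{v ≥ v 𝔪}`, `{v > v 𝔪}` and `{Sg}` are cut out by ideals (upper semicontinuity (c8) and closedness of the singular
  locus); `Sg` is specialization-closed; (strat) at `𝔪` in `A`-form — for primes `𝔮 ⊆ 𝔪` with `Sg 𝔮`,
  `v 𝔮 = v 𝔪 ↔ P ⊆ 𝔮` — and (adm) `Sg P`. Conclusion: `∃ h ∉ 𝔪, ∀ 𝔮 ∈ D(h): P ⊆ 𝔮 ↔ (Sg 𝔮 ∧ v 𝔮 = v 𝔪)`.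
  Proof: `h` kills the jump set `{v > v 𝔪}` (closed, `∌ 𝔪`) and the finitely many minimal primes of `{v ≥ v 𝔪} ∩ {Sg}`
  not contained in `𝔪` (Mathlib `Ideal.finite_minimalPrimes_of_isNoetherianRing`); a minimal prime `η ⊆ 𝔪` of that set has
  `v η = v 𝔪` by monotonicity, hence contains `P` by (strat).
* `strat_model_of_strat`, `adm_model_of_adm` (+ transport bricks) — the (strat) / (adm) conjuncts of
  `CanonicalGameClause` at `S = A_𝔪` (primes of `A_𝔪`) give the `A`-forms at the primes `𝔮 ⊆ 𝔪` of `A`, centre `P ∩ A`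
  (`(A_𝔪)_𝔭 ≃ A_{𝔭 ∩ A}`, Mathlib `IsLocalization.localizationLocalizationAtPrimeIsoLocalization`; `ι` iso-invariant (c6)).
* `stratumIff_iota_of_strat` — the `ι`-instantiation (`v := ι(A_𝔮)(F)`, `Sg := F ∈ 𝔪_{A_𝔮}²`) fed by the `S`-form
  (strat)+(adm): the ONLY inputs beyond the game clause are (c7)-monotonicity and the three closed superlevel sets on
  `D(h₀)`, in ideal form.
* `iotaOrd_localization_mono`, `stratumIff_iotaOrd_of_strat` — for the order function `iotaOrd` the monotonicity inputs are
  DISCHARGED from (c7) (p502169) given regular stalks on `D(h₀)`, and `Sg ↔ 2 ≤ iotaOrd`; what remains is upper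
  semicontinuity of the order along `D(h₀)` in ideal form (`{𝔮 : n ≤ ord_𝔮 F} = V(I_n) ∩ D(h₀)`; on a smooth affine model:
  Hasse derivatives, res-type-078 p502410 / res-type-039 p502844 at scheme level).

References: stratum-exactness clause = stub-9 (res-D-brk-1) TP5′/TP5″, registrar res-L1-w43-plan-1 (module `…LocalGameEFT4S`,
p504475); readback res-L1-w43-tri-2 TRIAGE v5 (D7) — OURS, AI planning/triage. Mathlib: `Ideal.finite_minimalPrimes_of_isNoetherianRing`,
`Ideal.exists_minimalPrimes_le`, `IsLocalization.localizationLocalizationAtPrimeIsoLocalization`, `…isPrime_of_isPrime_disjoint`,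
`…under_map_of_isPrime_disjoint`, `…map_under`.
-/

noncomputable section

set_option linter.dupNamespace false -- mandated namespace `Summit.<Summit>.<Problem>` of this single-conjunct summit

open IsLocalRing Literature.AlgebraicGeometry.Resolution
namespace Summit.ResolutionOfSingularities.ResolutionOfSingularities.Cruxes.HypersurfaceCentreConstruction.LocalEngine

namespace StratumIff

variable {A : Type} [CommRing A]

/-! ## §1. The abstract spectrum lemma -/

/-- **Stratum-exactness from (strat) + (adm) + monotonicity + closedness** (abstract form on `Spec A`, `A` Noetherian).
Data: `v : Spec A → Ordinal`, `Sg : Spec A → Prop`, a point `𝔪`, a basic open `D(h₀) ∋ 𝔪`, the centre point `P ⊆ 𝔪`.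
Hypotheses (on `D(h₀)`): `v` generization-monotone; `{v 𝔪 ≤ v}`, `{v 𝔪 < v}`, `{Sg}` cut out by ideals; `Sg` closed under
specialization; (strat) at `𝔪`: for primes `𝔮 ⊆ 𝔪` with `Sg 𝔮`, `v 𝔮 = v 𝔪 ↔ P ⊆ 𝔮`; (adm) `Sg P`.
Conclusion: for some `h ∉ 𝔪`, on `D(h)`: `P ⊆ 𝔮 ↔ (Sg 𝔮 ∧ v 𝔮 = v 𝔪)`. [OURS · L1 W4.3, kernel; tri-2 (D7) readback] -/
theorem stratumIff_of_strat [IsNoetherianRing A] (v : PrimeSpectrum A → Ordinal.{0}) (Sg : PrimeSpectrum A → Prop)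
    (𝔪 : PrimeSpectrum A) (h₀ : A) (hh₀ : h₀ ∉ 𝔪.asIdeal)
    (hmono : ∀ x y : PrimeSpectrum A, h₀ ∉ y.asIdeal → x.asIdeal ≤ y.asIdeal → v x ≤ v y)
    (hge : ∃ I : Ideal A, ∀ x : PrimeSpectrum A, h₀ ∉ x.asIdeal → (v 𝔪 ≤ v x ↔ I ≤ x.asIdeal))
    (hgt : ∃ I : Ideal A, ∀ x : PrimeSpectrum A, h₀ ∉ x.asIdeal → (v 𝔪 < v x ↔ I ≤ x.asIdeal))
    (hSg : ∃ I : Ideal A, ∀ x : PrimeSpectrum A, h₀ ∉ x.asIdeal → (Sg x ↔ I ≤ x.asIdeal))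
    (hSgmono : ∀ x y : PrimeSpectrum A, h₀ ∉ y.asIdeal → x.asIdeal ≤ y.asIdeal → Sg x → Sg y)
    (P : PrimeSpectrum A) (hP𝔪 : P.asIdeal ≤ 𝔪.asIdeal) (hSgP : Sg P)
    (hstrat : ∀ x : PrimeSpectrum A, x.asIdeal ≤ 𝔪.asIdeal → Sg x → (v x = v 𝔪 ↔ P.asIdeal ≤ x.asIdeal)) :
    ∃ h : A, h ∉ 𝔪.asIdeal ∧
      ∀ x : PrimeSpectrum A, h ∉ x.asIdeal → (P.asIdeal ≤ x.asIdeal ↔ (Sg x ∧ v x = v 𝔪)) := by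
  classical
  obtain ⟨Iα, hIα⟩ := hge
  obtain ⟨Igt, hIgt⟩ := hgt
  obtain ⟨I₂, hI₂⟩ := hSg
  -- (i) the jump set `{v > v 𝔪} = V(Igt) ∩ D(h₀)` misses `𝔪`
  have hIgt𝔪 : ¬ Igt ≤ 𝔪.asIdeal := fun hle => lt_irrefl (v 𝔪) ((hIgt 𝔪 hh₀).mpr hle)
  obtain ⟨h₁, hh₁I, hh₁𝔪⟩ := SetLike.not_le_iff_exists.mp hIgt𝔪
  -- (ii) the minimal primes of `{v ≥ v 𝔪} ∩ {Sg} = V(Iα ⊔ I₂)` not inside `𝔪` (finitely many)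
  set K : Ideal A := Iα ⊔ I₂ with hK
  have hfin : (K.minimalPrimes).Finite := Ideal.finite_minimalPrimes_of_isNoetherianRing A K
  have hbadfin : {η ∈ K.minimalPrimes | ¬ η ≤ 𝔪.asIdeal}.Finite := hfin.subset fun η hη => hη.1
  have hchoice : ∀ η ∈ {η ∈ K.minimalPrimes | ¬ η ≤ 𝔪.asIdeal}, ∃ g : A, g ∈ η ∧ g ∉ 𝔪.asIdeal :=
    fun η hη => SetLike.not_le_iff_exists.mp hη.2
  choose! g hg using hchoice
  have hh₂𝔪 : (∏ η ∈ hbadfin.toFinset, g η) ∉ 𝔪.asIdeal := by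
    rw [Ideal.IsPrime.prod_mem_iff]
    rintro ⟨η, hη, hgη⟩
    exact (hg η (hbadfin.mem_toFinset.mp hη)).2 hgη
  refine ⟨h₀ * h₁ * ∏ η ∈ hbadfin.toFinset, g η, ?_, fun x hx => ?_⟩
  · intro hmem
    rcases Ideal.IsPrime.mem_or_mem inferInstance hmem with h01 | h2
    · rcases Ideal.IsPrime.mem_or_mem inferInstance h01 with h0 | h1
      · exact hh₀ h0
      · exact hh₁𝔪 h1
    · exact hh₂𝔪 h2
  · have hh₀x : h₀ ∉ x.asIdeal := fun h => hx (Ideal.mul_mem_right _ _ (Ideal.mul_mem_right _ _ h))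
    have hh₁x : h₁ ∉ x.asIdeal := fun h => hx (Ideal.mul_mem_right _ _ (Ideal.mul_mem_left _ _ h))
    have hh₂x : (∏ η ∈ hbadfin.toFinset, g η) ∉ x.asIdeal := fun h => hx (Ideal.mul_mem_left _ _ h)
    constructor
    · -- along `V(P) ∩ D(h)`: `v P ≤ v x ≤ v 𝔪 = v P`, and `Sg` propagates from `P`
      intro hPx
      have hle : v x ≤ v 𝔪 := by
        by_contra hlt
        exact hh₁x (((hIgt x hh₀x).mp (not_le.mp hlt)) hh₁I)
      have hPv : v P = v 𝔪 := (hstrat P hP𝔪 hSgP).mpr le_rfl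
      have hge' : v 𝔪 ≤ v x := hPv ▸ hmono P x hh₀x hPx
      exact ⟨hSgmono P x hh₀x hPx hSgP, le_antisymm hle hge'⟩
    · -- a point of `{v = v 𝔪} ∩ {Sg} ∩ D(h)` lies over a minimal prime `η ⊆ 𝔪` of `V(K)`, and `P ⊆ η` by (strat)
      rintro ⟨hSgx, hvx⟩
      have hKx : K ≤ x.asIdeal := sup_le ((hIα x hh₀x).mp hvx.symm.le) ((hI₂ x hh₀x).mp hSgx)
      obtain ⟨η, hηK, hηx⟩ := Ideal.exists_minimalPrimes_le hKx
      haveI hηprime : η.IsPrime := hηK.1.1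
      have hη𝔪 : η ≤ 𝔪.asIdeal := by
        by_contra hbad
        have hgη := hg η ⟨hηK, hbad⟩
        refine hh₂x (hηx ?_)
        obtain ⟨c, hc⟩ := Finset.dvd_prod_of_mem g (hbadfin.mem_toFinset.mpr ⟨hηK, hbad⟩)
        rw [hc]
        exact Ideal.mul_mem_right _ _ hgη.1
      let y : PrimeSpectrum A := ⟨η, hηprime⟩
      have hh₀y : h₀ ∉ y.asIdeal := fun h => hh₀x (hηx h)
      have hvy : v y = v 𝔪 :=
        le_antisymm (hmono y 𝔪 hh₀ hη𝔪) ((hIα y hh₀y).mpr (le_sup_left.trans hηK.1.2))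
      have hSgy : Sg y := (hI₂ y hh₀y).mpr (le_sup_right.trans hηK.1.2)
      exact ((hstrat y hη𝔪 hSgy).mp hvy).trans hηx

/-! ## §2. Transport bricks: equal primes, and `(A_𝔪)_𝔭 ≃ A_{𝔭 ∩ A}` -/

section Transport

variable (ι : (R : Type) → [CommRing R] → R → Ordinal.{0})

/-- Equal prime ideals give the same `ι`-value at the localizations. [folklore] -/
theorem iota_localization_congr {I I' : Ideal A} (hI : I = I') [I.IsPrime] [I'.IsPrime] (F : A) :
    ι (Localization.AtPrime I) (algebraMap A (Localization.AtPrime I) F) =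
      ι (Localization.AtPrime I') (algebraMap A (Localization.AtPrime I') F) := by
  subst hI
  rfl

omit ι in
/-- Equal prime ideals: membership of `F` in `𝔪²` of the localization transports. [folklore] -/
theorem mem_sq_localization_congr {I I' : Ideal A} (hI : I = I') [I.IsPrime] [I'.IsPrime] (F : A) :
    algebraMap A (Localization.AtPrime I) F ∈ maximalIdeal (Localization.AtPrime I) ^ 2 ↔
      algebraMap A (Localization.AtPrime I') F ∈ maximalIdeal (Localization.AtPrime I') ^ 2 := by
  subst hI
  exact Iff.rfl

/-- **`(A_𝔪)_𝔭 ≃ A_{𝔭 ∩ A}` carries `ι`** (for a (c6)-iso-invariant `ι`): the value of `ι` at `F` in the localization of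
`A_𝔪` at a prime `𝔭` equals its value in `A_{𝔭 ∩ A}`. [folklore] -/
theorem iota_localization_localization_eq (hiso : IotaIsoInvariant ι) (𝔪 : Ideal A) [𝔪.IsPrime]
    (𝔭 : Ideal (Localization.AtPrime 𝔪)) [𝔭.IsPrime] (F : A) :
    ι (Localization.AtPrime 𝔭)
        (algebraMap (Localization.AtPrime 𝔪) (Localization.AtPrime 𝔭) (algebraMap A (Localization.AtPrime 𝔪) F)) =
      ι (Localization.AtPrime (𝔭.comap (algebraMap A (Localization.AtPrime 𝔪))))
        (algebraMap A (Localization.AtPrime (𝔭.comap (algebraMap A (Localization.AtPrime 𝔪)))) F) := by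
  let e : Localization.AtPrime (𝔭.comap (algebraMap A (Localization.AtPrime 𝔪))) ≃+* Localization.AtPrime 𝔭 :=
    (IsLocalization.localizationLocalizationAtPrimeIsoLocalization 𝔪.primeCompl 𝔭).toRingEquiv
  have h1 : algebraMap (Localization.AtPrime 𝔪) (Localization.AtPrime 𝔭) (algebraMap A (Localization.AtPrime 𝔪) F) =
      algebraMap A (Localization.AtPrime 𝔭) F :=
    (IsScalarTower.algebraMap_apply A (Localization.AtPrime 𝔪) (Localization.AtPrime 𝔭) F).symm
  have h2 : e (algebraMap A _ F) = algebraMap A (Localization.AtPrime 𝔭) F :=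
    (IsLocalization.localizationLocalizationAtPrimeIsoLocalization 𝔪.primeCompl 𝔭).commutes F
  rw [h1, ← h2]
  exact hiso _ _ e _

omit ι in
/-- The same transport for membership in `𝔪²` (a ring isomorphism of local rings maps `𝔪` onto `𝔪`). [folklore] -/
theorem mem_sq_localization_localization_iff (𝔪 : Ideal A) [𝔪.IsPrime]
    (𝔭 : Ideal (Localization.AtPrime 𝔪)) [𝔭.IsPrime] (F : A) :
    algebraMap (Localization.AtPrime 𝔪) (Localization.AtPrime 𝔭) (algebraMap A (Localization.AtPrime 𝔪) F) ∈
        maximalIdeal (Localization.AtPrime 𝔭) ^ 2 ↔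
      algebraMap A (Localization.AtPrime (𝔭.comap (algebraMap A (Localization.AtPrime 𝔪)))) F ∈
        maximalIdeal (Localization.AtPrime (𝔭.comap (algebraMap A (Localization.AtPrime 𝔪)))) ^ 2 := by
  let e : Localization.AtPrime (𝔭.comap (algebraMap A (Localization.AtPrime 𝔪))) ≃+* Localization.AtPrime 𝔭 :=
    (IsLocalization.localizationLocalizationAtPrimeIsoLocalization 𝔪.primeCompl 𝔭).toRingEquiv
  have h1 : algebraMap (Localization.AtPrime 𝔪) (Localization.AtPrime 𝔭) (algebraMap A (Localization.AtPrime 𝔪) F) =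
      algebraMap A (Localization.AtPrime 𝔭) F :=
    (IsScalarTower.algebraMap_apply A (Localization.AtPrime 𝔪) (Localization.AtPrime 𝔭) F).symm
  have h2 : e (algebraMap A _ F) = algebraMap A (Localization.AtPrime 𝔭) F :=
    (IsLocalization.localizationLocalizationAtPrimeIsoLocalization 𝔪.primeCompl 𝔭).commutes F
  rw [h1, ← h2, ← map_ringEquiv_maximalIdeal e, ← Ideal.map_pow, Ideal.apply_mem_of_equiv_iff]

/-- For a prime `𝔮 ⊆ 𝔪` of `A`: `𝔮 A_𝔪` is prime and contracts to `𝔮`. [folklore] -/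
theorem isPrime_map_and_comap_map_eq (𝔪 : Ideal A) [𝔪.IsPrime] (𝔮 : Ideal A) [𝔮.IsPrime] (h𝔮 : 𝔮 ≤ 𝔪) :
    (𝔮.map (algebraMap A (Localization.AtPrime 𝔪))).IsPrime ∧
      (𝔮.map (algebraMap A (Localization.AtPrime 𝔪))).comap (algebraMap A (Localization.AtPrime 𝔪)) = 𝔮 := by
  have hdisj : Disjoint (𝔪.primeCompl : Set A) (𝔮 : Set A) :=
    Set.disjoint_left.mpr fun a ha ha𝔮 => ha (h𝔮 ha𝔮)
  exact ⟨IsLocalization.isPrime_of_isPrime_disjoint 𝔪.primeCompl _ 𝔮 ‹_› hdisj,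
    IsLocalization.under_map_of_isPrime_disjoint 𝔪.primeCompl (Localization.AtPrime 𝔪) ‹_› hdisj⟩

/-- **TRANSPORT of (strat)** from the local ring `S = A_𝔪` to the model `A`: if the (strat) conjunct of
`CanonicalGameClause` holds at `(A_𝔪, F)` with centre prime `P ⊂ A_𝔪` — for every prime `𝔭 ∋ F` of `A_𝔪`,
`ι((A_𝔪)_𝔭) F = ι(A_𝔪) F ↔ P ≤ 𝔭` — then for every prime `𝔮 ⊆ 𝔪` of `A` with `F ∈ 𝔮`:
`ι(A_𝔮) F = ι(A_𝔪) F ↔ P ∩ A ⊆ 𝔮`. (`ι` iso-invariant, (c6).) [OURS · L1 W4.3, kernel] -/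
theorem strat_model_of_strat (hiso : IotaIsoInvariant ι) (𝔪 : Ideal A) [𝔪.IsPrime] (F : A)
    (P : Ideal (Localization.AtPrime 𝔪))
    (hstrat : ∀ (𝔭 : Ideal (Localization.AtPrime 𝔪)) [𝔭.IsPrime],
      algebraMap A (Localization.AtPrime 𝔪) F ∈ 𝔭 →
        (ι (Localization.AtPrime 𝔭) (algebraMap (Localization.AtPrime 𝔪) (Localization.AtPrime 𝔭)
            (algebraMap A (Localization.AtPrime 𝔪) F)) =
          ι (Localization.AtPrime 𝔪) (algebraMap A (Localization.AtPrime 𝔪) F) ↔ P ≤ 𝔭))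
    (𝔮 : Ideal A) [𝔮.IsPrime] (h𝔮 : 𝔮 ≤ 𝔪) (hF : F ∈ 𝔮) :
    ι (Localization.AtPrime 𝔮) (algebraMap A (Localization.AtPrime 𝔮) F) =
        ι (Localization.AtPrime 𝔪) (algebraMap A (Localization.AtPrime 𝔪) F) ↔
      P.comap (algebraMap A (Localization.AtPrime 𝔪)) ≤ 𝔮 := by
  obtain ⟨hprime, hcomap⟩ := isPrime_map_and_comap_map_eq 𝔪 𝔮 h𝔮
  haveI := hprime
  have hF' : algebraMap A (Localization.AtPrime 𝔪) F ∈ 𝔮.map (algebraMap A (Localization.AtPrime 𝔪)) :=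
    Ideal.mem_map_of_mem _ hF
  have key := hstrat (𝔮.map (algebraMap A (Localization.AtPrime 𝔪))) hF'
  rw [iota_localization_localization_eq ι hiso 𝔪 _ F, iota_localization_congr ι hcomap F] at key
  rw [key]
  constructor
  · intro hle
    exact (Ideal.comap_mono hle).trans hcomap.le
  · intro hle
    have hPeq : (P.comap (algebraMap A (Localization.AtPrime 𝔪))).map (algebraMap A (Localization.AtPrime 𝔪)) = P :=
      IsLocalization.map_under 𝔪.primeCompl (Localization.AtPrime 𝔪) P
    rw [← hPeq]
    exact Ideal.map_mono hle

omit ι in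
/-- **TRANSPORT of (adm)**: if `F ∈ 𝔪_{(A_𝔪)_Q}²` at every prime `Q ⊇ P` of `A_𝔪`, then `F ∈ 𝔪_{A_𝔮}²` at every prime
`𝔮 ⊆ 𝔪` of `A` with `P ∩ A ⊆ 𝔮`; in particular at `𝔮 = P ∩ A`. [OURS · L1 W4.3, kernel] -/
theorem adm_model_of_adm (𝔪 : Ideal A) [𝔪.IsPrime] (F : A) (P : Ideal (Localization.AtPrime 𝔪))
    (hadm : ∀ (Q : Ideal (Localization.AtPrime 𝔪)) [Q.IsPrime], P ≤ Q →
      algebraMap (Localization.AtPrime 𝔪) (Localization.AtPrime Q) (algebraMap A (Localization.AtPrime 𝔪) F) ∈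
        maximalIdeal (Localization.AtPrime Q) ^ 2)
    (𝔮 : Ideal A) [𝔮.IsPrime] (h𝔮 : 𝔮 ≤ 𝔪) (hP𝔮 : P.comap (algebraMap A (Localization.AtPrime 𝔪)) ≤ 𝔮) :
    algebraMap A (Localization.AtPrime 𝔮) F ∈ maximalIdeal (Localization.AtPrime 𝔮) ^ 2 := by
  obtain ⟨hprime, hcomap⟩ := isPrime_map_and_comap_map_eq 𝔪 𝔮 h𝔮
  haveI := hprime
  have hPQ : P ≤ 𝔮.map (algebraMap A (Localization.AtPrime 𝔪)) := by
    have hPeq : (P.comap (algebraMap A (Localization.AtPrime 𝔪))).map (algebraMap A (Localization.AtPrime 𝔪)) = P :=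
      IsLocalization.map_under 𝔪.primeCompl (Localization.AtPrime 𝔪) P
    rw [← hPeq]
    exact Ideal.map_mono hP𝔮
  have key := hadm (𝔮.map (algebraMap A (Localization.AtPrime 𝔪))) hPQ
  rwa [mem_sq_localization_localization_iff 𝔪 _ F, mem_sq_localization_congr hcomap F] at key

/-! ## §3. The `ι`-instantiation: stratum-exactness from the game clause's (strat)+(adm) at `S = A_𝔪` -/

/-- **STRATUM-EXACTNESS FROM THE GAME CLAUSE** (`ι` iso-invariant; `A` Noetherian; `F ∈ A`; `𝔪` prime; `D(h₀) ∋ 𝔪`).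
Inputs: the (strat) and (adm) conjuncts of `CanonicalGameClause` at the local ring `S = A_𝔪` with centre prime `P`
(`S`-form, primes of `A_𝔪`); (c7)-type generization monotonicity of `𝔮 ↦ ι(A_𝔮) F` on `D(h₀)`; the superlevel sets
`{ι(A_𝔪) F ≤ ι(A_𝔮) F}`, `{ι(A_𝔪) F < ι(A_𝔮) F}` and the singular locus `{F ∈ 𝔪_{A_𝔮}²}` cut out on `D(h₀)` by ideals, and
the singular locus specialization-closed on `D(h₀)`. Output: `h ∉ 𝔪` with, for every prime `𝔮 ∌ h`:
`P ∩ A ⊆ 𝔮 ↔ (F ∈ 𝔪_{A_𝔮}² ∧ ι(A_𝔮) F = ι(A_𝔪) F)` — the stratum iff of (open″) with `V(U)` read as `V(P ∩ A)`.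
[OURS · L1 W4.3, kernel; tri-2 (D7) readback] -/
theorem stratumIff_iota_of_strat [IsNoetherianRing A] (hiso : IotaIsoInvariant ι) (𝔪 : Ideal A) [𝔪.IsPrime] (F : A)
    (h₀ : A) (hh₀ : h₀ ∉ 𝔪)
    (hmono : ∀ (𝔮 𝔮' : Ideal A) [𝔮.IsPrime] [𝔮'.IsPrime], h₀ ∉ 𝔮' → 𝔮 ≤ 𝔮' →
      ι (Localization.AtPrime 𝔮) (algebraMap A (Localization.AtPrime 𝔮) F) ≤
        ι (Localization.AtPrime 𝔮') (algebraMap A (Localization.AtPrime 𝔮') F))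
    (hge : ∃ I : Ideal A, ∀ (𝔮 : Ideal A) [𝔮.IsPrime], h₀ ∉ 𝔮 →
      (ι (Localization.AtPrime 𝔪) (algebraMap A (Localization.AtPrime 𝔪) F) ≤
          ι (Localization.AtPrime 𝔮) (algebraMap A (Localization.AtPrime 𝔮) F) ↔ I ≤ 𝔮))
    (hgt : ∃ I : Ideal A, ∀ (𝔮 : Ideal A) [𝔮.IsPrime], h₀ ∉ 𝔮 →
      (ι (Localization.AtPrime 𝔪) (algebraMap A (Localization.AtPrime 𝔪) F) <
          ι (Localization.AtPrime 𝔮) (algebraMap A (Localization.AtPrime 𝔮) F) ↔ I ≤ 𝔮))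
    (hsing : ∃ I : Ideal A, ∀ (𝔮 : Ideal A) [𝔮.IsPrime], h₀ ∉ 𝔮 →
      (algebraMap A (Localization.AtPrime 𝔮) F ∈ maximalIdeal (Localization.AtPrime 𝔮) ^ 2 ↔ I ≤ 𝔮))
    (hsingmono : ∀ (𝔮 𝔮' : Ideal A) [𝔮.IsPrime] [𝔮'.IsPrime], h₀ ∉ 𝔮' → 𝔮 ≤ 𝔮' →
      algebraMap A (Localization.AtPrime 𝔮) F ∈ maximalIdeal (Localization.AtPrime 𝔮) ^ 2 →
        algebraMap A (Localization.AtPrime 𝔮') F ∈ maximalIdeal (Localization.AtPrime 𝔮') ^ 2)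
    (P : Ideal (Localization.AtPrime 𝔪)) [P.IsPrime]
    (hstrat : ∀ (𝔭 : Ideal (Localization.AtPrime 𝔪)) [𝔭.IsPrime],
      algebraMap A (Localization.AtPrime 𝔪) F ∈ 𝔭 →
        (ι (Localization.AtPrime 𝔭) (algebraMap (Localization.AtPrime 𝔪) (Localization.AtPrime 𝔭)
            (algebraMap A (Localization.AtPrime 𝔪) F)) =
          ι (Localization.AtPrime 𝔪) (algebraMap A (Localization.AtPrime 𝔪) F) ↔ P ≤ 𝔭))
    (hadm : ∀ (Q : Ideal (Localization.AtPrime 𝔪)) [Q.IsPrime], P ≤ Q →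
      algebraMap (Localization.AtPrime 𝔪) (Localization.AtPrime Q) (algebraMap A (Localization.AtPrime 𝔪) F) ∈
        maximalIdeal (Localization.AtPrime Q) ^ 2) :
    ∃ h : A, h ∉ 𝔪 ∧ ∀ (𝔮 : Ideal A) [𝔮.IsPrime], h ∉ 𝔮 →
      (P.comap (algebraMap A (Localization.AtPrime 𝔪)) ≤ 𝔮 ↔
        (algebraMap A (Localization.AtPrime 𝔮) F ∈ maximalIdeal (Localization.AtPrime 𝔮) ^ 2 ∧
          ι (Localization.AtPrime 𝔮) (algebraMap A (Localization.AtPrime 𝔮) F) =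
            ι (Localization.AtPrime 𝔪) (algebraMap A (Localization.AtPrime 𝔪) F))) := by
  -- the centre point `P ∩ A` of `Spec A`
  set P₀ : Ideal A := P.comap (algebraMap A (Localization.AtPrime 𝔪)) with hP₀
  haveI hP₀prime : P₀.IsPrime := Ideal.IsPrime.comap _
  have hP₀𝔪 : P₀ ≤ 𝔪 := by
    intro a ha
    by_contra ha𝔪
    have hunit : IsUnit (algebraMap A (Localization.AtPrime 𝔪) a) :=
      IsLocalization.map_units (Localization.AtPrime 𝔪) (⟨a, ha𝔪⟩ : 𝔪.primeCompl)
    exact (Ideal.IsPrime.ne_top ‹P.IsPrime›) (Ideal.eq_top_of_isUnit_mem _ ha hunit)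
  -- instantiate the abstract lemma at `v x = ι(A_x) F`, `Sg x = (F ∈ 𝔪_{A_x}²)`
  let v : PrimeSpectrum A → Ordinal.{0} := fun x =>
    ι (Localization.AtPrime x.asIdeal) (algebraMap A (Localization.AtPrime x.asIdeal) F)
  let Sg : PrimeSpectrum A → Prop := fun x =>
    algebraMap A (Localization.AtPrime x.asIdeal) F ∈ maximalIdeal (Localization.AtPrime x.asIdeal) ^ 2
  let m : PrimeSpectrum A := ⟨𝔪, ‹_›⟩
  let c : PrimeSpectrum A := ⟨P₀, hP₀prime⟩
  have hSgc : Sg c := adm_model_of_adm 𝔪 F P hadm P₀ hP₀𝔪 le_rfl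
  have hstratA : ∀ x : PrimeSpectrum A, x.asIdeal ≤ m.asIdeal → Sg x → (v x = v m ↔ c.asIdeal ≤ x.asIdeal) := by
    intro x hx hSgx
    have hFx : F ∈ x.asIdeal :=
      (IsLocalization.AtPrime.to_map_mem_maximal_iff (Localization.AtPrime x.asIdeal) x.asIdeal F).mp
        (Ideal.pow_le_self two_ne_zero hSgx)
    exact strat_model_of_strat ι hiso 𝔪 F P hstrat x.asIdeal hx hFx
  obtain ⟨Iα, hIα⟩ := hge
  obtain ⟨Igt, hIgt⟩ := hgt
  obtain ⟨I₂, hI₂⟩ := hsing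
  obtain ⟨h, hh𝔪, hh⟩ := stratumIff_of_strat v Sg m h₀ hh₀
    (fun x y hy hxy => hmono x.asIdeal y.asIdeal hy hxy)
    ⟨Iα, fun x hx => hIα x.asIdeal hx⟩ ⟨Igt, fun x hx => hIgt x.asIdeal hx⟩ ⟨I₂, fun x hx => hI₂ x.asIdeal hx⟩
    (fun x y hy hxy => hsingmono x.asIdeal y.asIdeal hy hxy) c hP₀𝔪 hSgc hstratA
  exact ⟨h, hh𝔪, fun 𝔮 _ h𝔮 => hh ⟨𝔮, ‹_›⟩ h𝔮⟩

end Transport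

/-! ## §4. The order function: monotonicity inputs discharged from (c7) -/

/-- **Generization monotonicity of the order along a model**: for primes `𝔮 ⊆ 𝔮'` of `A` with `A_𝔮'` regular,
`ord_{A_𝔮} F ≤ ord_{A_𝔮'} F` (`A_𝔮 ≃` the localization of `A_𝔮'` at `𝔮 A_𝔮'`; (c7) for `iotaOrd`, p502169, via the
tree's `mem_pow_of_algebraMap_mem_pow` = Zariski–Nagata `𝔭⁽ⁿ⁾ ⊆ 𝔪ⁿ`). [cite: CossartPiltant2008, Prop. 4.2 (proof)] -/
theorem iotaOrd_localization_mono (F : A) (𝔮 𝔮' : Ideal A) [𝔮.IsPrime] [𝔮'.IsPrime] (hle : 𝔮 ≤ 𝔮')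
    (hreg : IsRegularLocalRing (Localization.AtPrime 𝔮')) :
    iotaOrd (Localization.AtPrime 𝔮) (algebraMap A (Localization.AtPrime 𝔮) F) ≤
      iotaOrd (Localization.AtPrime 𝔮') (algebraMap A (Localization.AtPrime 𝔮') F) := by
  obtain ⟨hprime, hcomap⟩ := isPrime_map_and_comap_map_eq 𝔮' 𝔮 hle
  haveI := hprime
  have h := iotaOrd_generization_le_of_isRegularLocalRing (Localization.AtPrime 𝔮')
    (𝔮.map (algebraMap A (Localization.AtPrime 𝔮')))
    (Localization.AtPrime (𝔮.map (algebraMap A (Localization.AtPrime 𝔮'))))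
    (algebraMap A (Localization.AtPrime 𝔮') F)
  rwa [iota_localization_localization_eq iotaOrd iotaOrd_isoInvariant 𝔮' _ F,
    iota_localization_congr iotaOrd hcomap F] at h

/-- `F ∈ 𝔪_{A_𝔮}² ↔ 2 ≤ ord_{A_𝔮} F`. [folklore] -/
theorem mem_sq_iff_two_le_iotaOrd (F : A) (𝔮 : Ideal A) [𝔮.IsPrime] :
    algebraMap A (Localization.AtPrime 𝔮) F ∈ maximalIdeal (Localization.AtPrime 𝔮) ^ 2 ↔
      (2 : Ordinal) ≤ iotaOrd (Localization.AtPrime 𝔮) (algebraMap A (Localization.AtPrime 𝔮) F) := by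
  have h := natCast_le_iotaOrd_iff (Localization.AtPrime 𝔮) (algebraMap A (Localization.AtPrime 𝔮) F) 2
  rw [Nat.cast_ofNat] at h
  exact h.symm

/-- **STRATUM-EXACTNESS FOR THE ORDER FUNCTION** at a finite-type (indeed any Noetherian) model `(A, 𝔪, F)` whose stalks are
regular on `D(h₀) ∋ 𝔪`: given the (strat)+(adm) conjuncts of `CanonicalGameClause` for `ι = iotaOrd` at `S = A_𝔪` with
centre `P`, and UPPER SEMICONTINUITY OF THE ORDER along `D(h₀)` in ideal form (`{𝔮 : n ≤ ord_𝔮 F} ∩ D(h₀) = V(I_n) ∩ D(h₀)`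
for every `n : ℕ`; on a smooth affine model these are the Hasse-derivative ideals), there is `h ∉ 𝔪` with, on `D(h)`:
`P ∩ A ⊆ 𝔮 ↔ (F ∈ 𝔪_{A_𝔮}² ∧ ord_𝔮 F = ord_𝔪 F)`. Monotonicity is discharged by (c7) (`iotaOrd_localization_mono`); the
singular locus is the level `n = 2`. [OURS · L1 W4.3, kernel] -/
theorem stratumIff_iotaOrd_of_strat [IsNoetherianRing A] (𝔪 : Ideal A) [𝔪.IsPrime] (F : A)
    (hF0 : algebraMap A (Localization.AtPrime 𝔪) F ≠ 0) (h₀ : A) (hh₀ : h₀ ∉ 𝔪)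
    (hreg : ∀ (𝔮 : Ideal A) [𝔮.IsPrime], h₀ ∉ 𝔮 → IsRegularLocalRing (Localization.AtPrime 𝔮))
    (husc : ∀ n : ℕ, ∃ I : Ideal A, ∀ (𝔮 : Ideal A) [𝔮.IsPrime], h₀ ∉ 𝔮 →
      ((n : Ordinal) ≤ iotaOrd (Localization.AtPrime 𝔮) (algebraMap A (Localization.AtPrime 𝔮) F) ↔ I ≤ 𝔮))
    (P : Ideal (Localization.AtPrime 𝔪)) [P.IsPrime]
    (hstrat : ∀ (𝔭 : Ideal (Localization.AtPrime 𝔪)) [𝔭.IsPrime],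
      algebraMap A (Localization.AtPrime 𝔪) F ∈ 𝔭 →
        (iotaOrd (Localization.AtPrime 𝔭) (algebraMap (Localization.AtPrime 𝔪) (Localization.AtPrime 𝔭)
            (algebraMap A (Localization.AtPrime 𝔪) F)) =
          iotaOrd (Localization.AtPrime 𝔪) (algebraMap A (Localization.AtPrime 𝔪) F) ↔ P ≤ 𝔭))
    (hadm : ∀ (Q : Ideal (Localization.AtPrime 𝔪)) [Q.IsPrime], P ≤ Q →
      algebraMap (Localization.AtPrime 𝔪) (Localization.AtPrime Q) (algebraMap A (Localization.AtPrime 𝔪) F) ∈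
        maximalIdeal (Localization.AtPrime Q) ^ 2) :
    ∃ h : A, h ∉ 𝔪 ∧ ∀ (𝔮 : Ideal A) [𝔮.IsPrime], h ∉ 𝔮 →
      (P.comap (algebraMap A (Localization.AtPrime 𝔪)) ≤ 𝔮 ↔
        (algebraMap A (Localization.AtPrime 𝔮) F ∈ maximalIdeal (Localization.AtPrime 𝔮) ^ 2 ∧
          iotaOrd (Localization.AtPrime 𝔮) (algebraMap A (Localization.AtPrime 𝔮) F) =
            iotaOrd (Localization.AtPrime 𝔪) (algebraMap A (Localization.AtPrime 𝔪) F))) := by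
  -- the order of `F` at `𝔪` is a natural number `ν`
  haveI : IsRegularLocalRing (Localization.AtPrime 𝔪) := hreg 𝔪 hh₀
  have hlt := iotaOrd_lt_omega0_of_ne_zero (Localization.AtPrime 𝔪) hF0
  obtain ⟨ν, hν⟩ := Ordinal.lt_omega0.mp hlt
  refine stratumIff_iota_of_strat iotaOrd iotaOrd_isoInvariant 𝔪 F h₀ hh₀
    (fun 𝔮 𝔮' _ _ h𝔮' hle => iotaOrd_localization_mono F 𝔮 𝔮' hle (hreg 𝔮' h𝔮')) ?_ ?_ ?_ ?_ P hstrat hadm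
  · obtain ⟨I, hI⟩ := husc ν
    exact ⟨I, fun 𝔮 _ h𝔮 => by rw [hν]; exact hI 𝔮 h𝔮⟩
  · obtain ⟨I, hI⟩ := husc (ν + 1)
    refine ⟨I, fun 𝔮 _ h𝔮 => ?_⟩
    rw [hν, ← hI 𝔮 h𝔮, Nat.cast_succ, Order.add_one_le_iff]
  · obtain ⟨I, hI⟩ := husc 2
    refine ⟨I, fun 𝔮 _ h𝔮 => ?_⟩
    rw [mem_sq_iff_two_le_iotaOrd]
    simpa only [Nat.cast_ofNat] using hI 𝔮 h𝔮
  · intro 𝔮 𝔮' _ _ h𝔮' hle hSg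
    rw [mem_sq_iff_two_le_iotaOrd] at hSg ⊢
    exact hSg.trans (iotaOrd_localization_mono F 𝔮 𝔮' hle (hreg 𝔮' h𝔮'))

end StratumIff
end Summit.ResolutionOfSingularities.ResolutionOfSingularities.Cruxes.HypersurfaceCentreConstruction.LocalEngine
end
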